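import Summits.BirchSwinnertonDyer.BirchSwinnertonDyer.Theorems.PrintCFramBottomClassIndexLawFiveLeLevelDictionaryDescent
import Summits.BirchSwinnertonDyer.BirchSwinnertonDyer.Theorems.PrintCFramBottomClassIndexLawFiveLeLevelDictionaryBetaSource
import Summits.BirchSwinnertonDyer.BirchSwinnertonDyer.Theorems.PrintCFramBottomClassIndexLawFiveLeSelmerCountCharacterBridge
import HarnessLib

/-!
# Route `PrintCFram`, crux C2 `BottomClassIndexLawFiveLe` (stmt-BirchSwinnertonDyer-20372), line
# `eisenstein-resource-bdp-line` (registry v19/v20, stubs B1-level / B1-sha): **THE REVERSE BRIDGE FOR RELAXED CLASSES** —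
# `θ`-isotypic characters of `Γ_L` unramified outside `S` INJECT into `H¹(Γ_ℚ, A; S)`: `#V ≤ #h1Unramified A S`
# (cell `bsd-print-cfram`, width seat `bsd-line-cfram-p1-w2` g10; helper `--supports` 20372; 0 defs, 0 facts, 0 sorry)

HONEST FRAMING. Nothing about BSD is proved here and no stub is closed. Seat g9's bridge
`SelmerCount.exists_characters_natCard_h1Unramified_le` (p675287) bounds `#H¹(Γ_ℚ, A; S)` ABOVE by the number of admissible characters of
`Γ_K` (open kernel, unramified outside `S`, `θ`-isotypic) — the input of the class-group UPPER counts (w7 g3/g4, w4 g10). This file is the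
converse direction, needed by the LOWER bound of the census (seat g10 `…SelmerCountLowerBound` / `…SelmerCountCoalignedOfLocal`:
«CO-ALIGNED ∧ `#R_rel(Φ) ≥ p²` ⟹ `Ш(W)[p] ≠ 0`»): every finite group `V` of such characters INJECTS into `h1Unramified A S`. Ingredients,
both landed for EVERYWHERE-unramified data and re-proved here with a set `S` of admissible ramification (same proofs): w5 g3's TRANSPORT
`Γ_L → res(Γ_L)` of an eigen-character (`LevelDictionaryBeta.exists_addHom_on_range_of_absGaloisHom`) and w4 g8's LINK
(`LevelDictionary.exists_unramified_class_of_hom_of_le_ker`: inflation–restriction surjectivity at index prime to `p`, `H²(Γ/N', A) = 0`).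

* §1 `exists_mem_inertia_over_of_absGaloisRestrict_mem` — inertia lifts along `res` ABOVE THE SAME PLACE (`u ∩ ℚ = ℓ`).
* §2 `exists_addHom_on_range_of_absGaloisHom_outside` — the `S`-transport: `κ ≠ 1` with open kernel, unramified at the primes of `L` above
  places outside `S`, `r`-eigen ⊢ `G = κ ∘ res⁻¹` on `N' = res Γ_L`: continuous, additive, `G(g n g⁻¹) = r(g) G(n)`, killing `N' ∩ I_𝔓` for
  `𝔓` above `ℓ ∉ S`, `G ∘ res = κ`, non-zero.
* §3 `exists_class_of_hom_of_le_ker_outside` — the `S`-LINK (any number field `K`): `N' ⊴ Γ_K` open of index prime to `p` acting trivially on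
  `A` (`#A = p`), `G₀` continuous additive equivariant on `N'`, killing `N' ∩ I_𝔓` for `𝔓` above `v ∉ S`, non-zero ⊢ a continuous crossed
  homomorphism `w` with `w|_{N'} = G₀`, non-zero class, principal on `I_𝔓` for `𝔓` above `v ∉ S`.
* §4 **`natCard_characters_le_natCard_h1Unramified`** — `A` of prime order `p` with character `θ`, `L/ℚ` Galois, `p ∤ [L:ℚ]`, `θ(res Γ_L) = 1`,
  `S` finite, `V` a finite subgroup of characters `Γ_L →* 𝔽_p` with open kernels, unramified above the places outside `S`, `θ`-isotypic
  ⊢ **`#V ≤ #h1Unramified A S`** (`κ ↦ [w_κ]`, `1 ↦ 0`, is injective: coboundaries vanish on `N'`).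

USE (B1, CASE R ∧ EVEN-IRREGULAR): with `A = Φ.Sub = 𝔽_p(ψ)`, `L = K'` (w6 g3's CM field, `res Γ_{K'} ⊆ ker θ_S`, `p ∤ [K':ℚ]`), `S = S_p`:
a SUPPLY of `p²` `ψ`-isotypic characters of `Γ_{K'}` unramified outside `p` — Kummer characters of the `θ_e`-radicals (Herbrand's
`θ_e`-unit, w7 g4 `UnitsEvenChiComponentRankOne`; one class radical when `θ_e` is irregular) — gives `#R_rel(ψ) ≥ p²`, the hypothesis of
`exists_sha_ne_zero_of_forall_exists_adaptedRoot_of_sq_le_of_cmRamified` (p681509). The Kummer supply itself is NOT in this file.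

THEOREMS ONLY; no definition, no named fact, no `sorry`. BSD is not proved by any of this; no summit statement is proved by this seat.
References: [SerreGaloisCohomology1997] I.§2.6 (b), I.§5.1; [NeukirchSchmidtWingberg2008] (1.6.7); [NeukirchANT1999] Ch. I §9 (9.4)–(9.6),
Ch. IV §1; [Washington1997] §10.2 (reflection); seat notes w2g9, w2g10, w4g8, w5g3, w7g3.
-/

set_option autoImplicit false
-- `…BirchSwinnertonDyer.BirchSwinnertonDyer.Theorems…` is the problem's mandated namespace (D-0017).
set_option linter.dupNamespace false

noncomputable section

open scoped Classical Pointwise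

namespace Summit.BirchSwinnertonDyer.BirchSwinnertonDyer.Theorems.PrintCFram.SelmerCount

open NumberField IsDedekindDomain Field
open Literature.NumberTheory.EllipticCurves Literature.NumberTheory.GaloisRepresentations
open Summit.BirchSwinnertonDyer.Rank1Residual
open Summit.BirchSwinnertonDyer.Rank1Residual.X11b
open Summit.BirchSwinnertonDyer.BirchSwinnertonDyer.Theorems.PrintCFram.LevelDictionary
open Summit.BirchSwinnertonDyer.BirchSwinnertonDyer.Theorems.PrintCFram.LevelDictionaryBeta

variable {p : ℕ} [hp : Fact p.Prime]

/-! ## §1 Inertia lifts along `res`, remembering the place -/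

section Lift

variable {L : Type} [Field L] [NumberField L]

/-- **Inertia lifts along `res`, OVER THE SAME PLACE.** If `res σ` lies in the inertia group of a prime `𝔓` of `\bar ℤ` above a place
`ℓ` of `ℚ`, then `σ` lies in the inertia group of a prime `𝔔` of `\bar ℤ_L` above a place `u` of `L` with `u ∩ ℚ = ℓ`
(w5 g3's `exists_mem_inertia_of_absGaloisRestrict_mem`, keeping the place). [cite: NeukirchANT1999, Ch. I §9 (9.4)–(9.6)] -/
theorem exists_mem_inertia_over_of_absGaloisRestrict_mem {ℓ : HeightOneSpectrum (𝓞 ℚ)}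
    {𝔓 : Ideal (absIntegers (𝓞 ℚ) ℚ)} (h𝔓 : 𝔓 ∈ ℓ.primesAbove) {σ : absoluteGaloisGroup L}
    (hσ : absGaloisRestrict ℚ L σ ∈ 𝔓.inertia (absoluteGaloisGroup ℚ)) :
    ∃ (u : HeightOneSpectrum (𝓞 L)) (𝔔 : Ideal (absIntegers (𝓞 L) L)), u.under (𝓞 ℚ) = ℓ ∧ 𝔔 ∈ u.primesAbove ∧
      σ ∈ 𝔔.inertia (absoluteGaloisGroup L) := by
  haveI := h𝔓.1
  obtain ⟨𝔔, h𝔔prime, h𝔔⟩ := exists_isPrime_comap_absIntegersMap_eq ℚ L 𝔓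
  haveI := h𝔔prime
  obtain ⟨u, hu, hu𝔔, -⟩ := exists_heightOneSpectrum_of_comap_absIntegersMap_mem_primesAbove
    (K := ℚ) (M := L) (v := ℓ) (𝔔 := 𝔔) (by rw [h𝔔]; exact h𝔓)
  refine ⟨u, 𝔔, HeightOneSpectrum.ext (by rw [HeightOneSpectrum.under_asIdeal]; exact hu), hu𝔔, ?_⟩
  rw [← comap_inertia_comap_absIntegersMap ℚ L 𝔔, Subgroup.mem_comap, h𝔔]
  exact hσ

end Lift

/-! ## §2 The transport `Γ_L → N' = res(Γ_L)` of an eigen-character unramified outside `S` -/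

section Transport

variable {L : Type} [Field L] [NumberField L]

/-- **THE TRANSPORT OF AN EIGEN-CHARACTER UNRAMIFIED OUTSIDE `S`** (the `S`-version of w5 g3's
`exists_addHom_on_range_of_absGaloisHom`). `L/ℚ` finite Galois, `r : Γ_ℚ →* 𝔽_pˣ`, `S` a set of finite places of `ℚ`;
`κ : Γ_L →* 𝔽_p` with `κ ≠ 1`, open kernel, trivial on the inertia group of every prime of `\bar ℤ_L` above a place `u` of `L` with
`u ∩ ℚ ∉ S`, and the eigen-law `κ(θ_γ σ) = κ(σ)^{(r γ).val}`. THEN `G = κ ∘ res⁻¹` (extended by `0`) is continuous and additive on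
`N' = res(Γ_L)`, satisfies `G(g n g⁻¹) = r(g)·G(n)`, kills `N' ∩ I_𝔓` for every `𝔓` above a place `ℓ ∉ S`, and is not identically zero
on `N'`. [cite: NeukirchANT1999, Ch. IV §1 and Ch. I §9 (9.4)–(9.6)] -/
theorem exists_addHom_on_range_of_absGaloisHom_outside [IsGalois ℚ L] [NeZero p] (r : absoluteGaloisGroup ℚ →* (ZMod p)ˣ)
    (S : Set (HeightOneSpectrum (𝓞 ℚ)))
    (κ : absoluteGaloisGroup L →* Multiplicative (ZMod p)) (hκ1 : κ ≠ 1)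
    (hopen : IsOpen (κ.ker : Set (absoluteGaloisGroup L)))
    (hinert : ∀ (u : HeightOneSpectrum (𝓞 L)), u.under (𝓞 ℚ) ∉ S → ∀ (𝔔 : Ideal (absIntegers (𝓞 L) L)), 𝔔 ∈ u.primesAbove →
      ∀ g ∈ 𝔔.inertia (absoluteGaloisGroup L), κ g = 1)
    (heigen : ∀ (γ : absoluteGaloisGroup ℚ) (σ : absoluteGaloisGroup L),
      κ (absGaloisOuterConj ℚ L γ σ) = (κ σ) ^ ((r γ : (ZMod p)ˣ) : ZMod p).val) :
    ∃ G : absoluteGaloisGroup ℚ → ZMod p,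
      (Continuous fun n : (absGaloisRestrict ℚ L).range => G n) ∧
      (∀ a ∈ (absGaloisRestrict ℚ L).range, ∀ b ∈ (absGaloisRestrict ℚ L).range, G (a * b) = G a + G b) ∧
      (∀ g, ∀ n ∈ (absGaloisRestrict ℚ L).range, G (g * n * g⁻¹) = ((r g : (ZMod p)ˣ) : ZMod p) * G n) ∧
      (∀ (ℓ : HeightOneSpectrum (𝓞 ℚ)), ℓ ∉ S → ∀ (𝔓 : Ideal (absIntegers (𝓞 ℚ) ℚ)), 𝔓 ∈ ℓ.primesAbove →
        ∀ n ∈ (absGaloisRestrict ℚ L).range, n ∈ 𝔓.inertia (absoluteGaloisGroup ℚ) → G n = 0) ∧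
      (∀ σ : absoluteGaloisGroup L, G (absGaloisRestrict ℚ L σ) = Multiplicative.toAdd (κ σ)) ∧
      ∃ n ∈ (absGaloisRestrict ℚ L).range, G n ≠ 0 := by
  -- the inverse `res⁻¹ : N' → Γ_L`
  let ι : (absGaloisRestrict ℚ L).range → absoluteGaloisGroup L := fun h =>
    (MonoidHom.ofInjective (f := (absGaloisRestrict ℚ L).toMonoidHom)
      (fun _ _ h => absGaloisRestrict_injective ℚ L h)).symm h
  have hι : ∀ σ : absoluteGaloisGroup L, ι ⟨absGaloisRestrict ℚ L σ, ⟨σ, rfl⟩⟩ = σ := fun σ =>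
    absGaloisRestrict_injective ℚ L (MonoidHom.apply_ofInjective_symm _ _)
  -- `G = κ ∘ res⁻¹` on `N'`, `0` elsewhere
  let G : absoluteGaloisGroup ℚ → ZMod p := fun g =>
    if h : g ∈ (absGaloisRestrict ℚ L).range then Multiplicative.toAdd (κ (ι ⟨g, h⟩)) else 0
  have hG : ∀ σ : absoluteGaloisGroup L, G (absGaloisRestrict ℚ L σ) = Multiplicative.toAdd (κ σ) := fun σ => by
    simp only [G, dif_pos (show absGaloisRestrict ℚ L σ ∈ (absGaloisRestrict ℚ L).range from ⟨σ, rfl⟩), hι]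
  have hGsub : ∀ h : (absGaloisRestrict ℚ L).range, G h = Multiplicative.toAdd (κ (ι h)) := fun h => by
    simp only [G, dif_pos h.2]
  refine ⟨G, ?_, ?_, ?_, ?_, hG, ?_⟩
  · -- continuity on `N'`: `toAdd ∘ κ ∘ res⁻¹`
    have hκc : Continuous κ := by
      refine continuous_of_continuousAt_one κ ?_
      rw [ContinuousAt, map_one]
      refine fun U hU => Filter.mem_map.mpr (Filter.mem_of_superset (hopen.mem_nhds (by simp)) ?_)
      intro g hg
      rw [SetLike.mem_coe, MonoidHom.mem_ker] at hg
      rw [Set.mem_preimage, hg]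
      exact mem_of_mem_nhds hU
    have hc : Continuous fun h : (absGaloisRestrict ℚ L).range => Multiplicative.toAdd (κ (ι h)) :=
      continuous_of_discreteTopology.comp (hκc.comp continuous_rangeInverse)
    exact hc.congr fun h => (hGsub h).symm
  · rintro a ⟨σ, rfl⟩ b ⟨τ, rfl⟩
    change G (absGaloisRestrict ℚ L σ * absGaloisRestrict ℚ L τ) = G (absGaloisRestrict ℚ L σ) + G (absGaloisRestrict ℚ L τ)
    rw [← map_mul, hG, hG, hG, map_mul, toAdd_mul]
  · rintro g n ⟨σ, rfl⟩
    change G (g * absGaloisRestrict ℚ L σ * g⁻¹) = _ * G (absGaloisRestrict ℚ L σ)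
    rw [← Literature.NumberTheory.GaloisRepresentations.absGaloisRestrict_absGaloisOuterConj, hG, hG, heigen,
      toAdd_pow, nsmul_eq_mul, ZMod.natCast_zmod_val]
  · rintro ℓ hℓ 𝔓 h𝔓 n ⟨σ, rfl⟩ hnI
    obtain ⟨u, 𝔔, hu, hu𝔔, hσ⟩ := exists_mem_inertia_over_of_absGaloisRestrict_mem h𝔓 hnI
    change G (absGaloisRestrict ℚ L σ) = 0
    rw [hG, hinert u (by rw [hu]; exact hℓ) 𝔔 hu𝔔 σ hσ, toAdd_one]
  · by_contra hall
    push Not at hall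
    apply hκ1
    ext σ
    have h := hall (absGaloisRestrict ℚ L σ) ⟨σ, rfl⟩
    rw [hG, toAdd_eq_zero] at h
    rw [h, MonoidHom.one_apply]

end Transport

/-! ## §3 THE LINK, unramified outside `S` -/

section Link

variable {K : Type} [Field K] [NumberField K]
variable {A : Type} [AddCommGroup A] [DistribMulAction (absoluteGaloisGroup K) A] [TopologicalSpace A]
  [DiscreteTopology A]

/-- **THE LINK, UNRAMIFIED OUTSIDE `S`** (the `S`-version of w4 g8's `LevelDictionary.exists_unramified_class_of_hom_of_le_ker`, same
proof). `A` a discrete `Γ_K`-module of PRIME order `p` with continuous orbit maps; `N' ⊴ Γ_K` an OPEN normal subgroup of finite index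
PRIME TO `p` acting trivially on `A`; `G₀ : Γ_K → A` continuous and additive on `N'`, `Γ_K`-equivariant on `N'`, killing `N' ∩ I_𝔓` for every
prime `𝔓` of `\bar ℤ_K` above a place `v ∉ S`, non-zero on `N'`. THEN there is a continuous crossed homomorphism `w : Γ_K → A` with
`w|_{N'} = G₀|_{N'}`, NON-ZERO class, principal on `I_𝔓` for every `𝔓` above a place `v ∉ S` — i.e. `[w] ∈ H¹(Γ_K, A; S)`.
[cite: SerreGaloisCohomology1997, I.§2.6 (b)] [cite: NeukirchSchmidtWingberg2008, (1.6.7)] -/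
theorem exists_class_of_hom_of_le_ker_outside (hcard : Nat.card A = p)
    (hcont : ∀ a : A, Continuous fun g : absoluteGaloisGroup K ↦ g • a)
    (N' : Subgroup (absoluteGaloisGroup K)) [N'.Normal] (hopen : IsOpen (N' : Set (absoluteGaloisGroup K)))
    (hN'le : N' ≤ (MulAction.toPermHom (absoluteGaloisGroup K) A).ker)
    (hidx0 : N'.index ≠ 0) (hcop : Nat.Coprime N'.index p)
    (S : Set (HeightOneSpectrum (𝓞 K)))
    (G₀ : absoluteGaloisGroup K → A) (hGc : Continuous fun n : N' ↦ G₀ n)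
    (hadd : ∀ a ∈ N', ∀ b ∈ N', G₀ (a * b) = G₀ a + G₀ b)
    (hconj : ∀ (g : absoluteGaloisGroup K), ∀ n ∈ N', G₀ (g * n * g⁻¹) = g • G₀ n)
    (hI : ∀ (v : HeightOneSpectrum (𝓞 K)), v ∉ S → ∀ (𝔓 : Ideal (absIntegers (𝓞 K) K)), 𝔓 ∈ v.primesAbove →
      ∀ n ∈ N', n ∈ 𝔓.inertia (absoluteGaloisGroup K) → G₀ n = 0)
    (hne : ∃ n ∈ N', G₀ n ≠ 0) :
    ∃ w : contOneCocycles (discreteTopRep (absoluteGaloisGroup K) A),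
      oneCocycleClass _ w ≠ 0 ∧ (∀ n ∈ N', w.1 n = G₀ n) ∧
      ∀ (v : HeightOneSpectrum (𝓞 K)), v ∉ S → ∀ (𝔓 : Ideal (absIntegers (𝓞 K) K)), 𝔓 ∈ v.primesAbove →
        ∃ a : A, ∀ g ∈ 𝔓.inertia (absoluteGaloisGroup K), w.1 g = g • a - a := by
  have hker : ∀ n ∈ N', ∀ a : A, n • a = a := fun n hn ↦
    (HerbrandLineRestriction.mem_ker_toPermHom_iff n).1 (hN'le hn)
  have hpA : ∀ a : A, p • a = 0 := HerbrandLineRestriction.prime_nsmul_eq_zero_of_card_prime hcard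
  obtain ⟨u, -, hu⟩ := Nat.exists_mul_mod_eq_one_of_coprime hcop hp.out.one_lt
  haveI : CompactSpace (absoluteGaloisGroup K) := by
    change CompactSpace (AlgebraicClosure K ≃ₐ[K] AlgebraicClosure K); infer_instance
  haveI : TotallyDisconnectedSpace (absoluteGaloisGroup K) := by
    change TotallyDisconnectedSpace (AlgebraicClosure K ≃ₐ[K] AlgebraicClosure K); infer_instance
  haveI : IsClosed (N' : Set (absoluteGaloisGroup K)) := N'.isClosed_of_isOpen hopen
  set ρ := LocBridge.ofSMul A (isOpen_stabilizer_of_continuous_smul hcont) with hρ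
  let y : contOneCocycles (subgroupRep ρ.toTopRep N') :=
    ⟨⟨fun n ↦ G₀ n, hGc⟩, fun a b ↦ by
      change G₀ ((a : absoluteGaloisGroup K) * b) = G₀ a + (a : absoluteGaloisGroup K) • G₀ b
      rw [hadd a a.2 b b.2, hker a a.2]⟩
  have hinv : ∀ g : absoluteGaloisGroup K,
      conjMap ρ.toTopRep N' g 1 (oneCocycleClass _ y) = oneCocycleClass _ y := by
    intro g
    refine (conjMap_oneCocycleClass ρ.toTopRep N' g y).trans (congrArg _ (Subtype.ext ?_))
    ext n
    rw [conj_pullback_apply]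
    change g • G₀ ((subgroupConj N' g n : N') : absoluteGaloisGroup K) = G₀ n
    rw [subgroupConj_apply_coe]
    have h := hconj g⁻¹ n n.2
    rw [inv_inv] at h
    rw [h, smul_inv_smul]
  haveI : Subsingleton (continuousCohomology 2 (ContinuousRep.quotientInvariants N' ρ).toTopRep) :=
    subsingleton_continuousCohomology_two_quotientInvariants_of_coprime (K := K) (A := A) hcont hpA N'
      hopen hidx0 hu
  obtain ⟨xc, hxc⟩ :=
    MultTransportTwistedDescent.exists_resSubgroup_eq_of_forall_conjMap_eq_of_subsingleton_two N' ρ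
      (oneCocycleClass _ y) hinv
  obtain ⟨w, rfl⟩ := oneCocycleClass_surjective _ xc
  have hwN : ∀ n ∈ N', w.1 n = G₀ n := by
    rw [resSubgroup_oneCocycleClass] at hxc
    have h0 := sub_eq_zero.2 hxc
    change oneCocycleClass (subgroupRep ρ.toTopRep N') _ - oneCocycleClass (subgroupRep ρ.toTopRep N') y = 0
      at h0
    rw [← oneCocycleClass_sub, oneCocycleClass_eq_zero_iff] at h0
    obtain ⟨a, ha⟩ := h0
    intro n hn
    have h1 := ha ⟨n, hn⟩
    rw [Submodule.coe_sub, ContinuousMap.sub_apply, resSubgroup_pullback_apply] at h1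
    change w.1 n - G₀ n = n • a - a at h1
    rwa [hker n hn, sub_self, sub_eq_zero] at h1
  refine ⟨w, fun h0 ↦ ?_, hwN, fun v hv 𝔓 h𝔓 ↦ ?_⟩
  · -- `[w] ≠ 0`: a coboundary vanishes on `N'`, `G₀` does not
    obtain ⟨a, ha⟩ := (oneCocycleClass_eq_zero_iff _ w).1 h0
    obtain ⟨n, hn, hne'⟩ := hne
    apply hne'
    rw [← hwN n hn, ha n]
    change n • a - a = 0
    rw [hker n hn, sub_self]
  · -- principal on `I_𝔓`, `𝔓` over `v ∉ S`: vanishing on `I_𝔓 ∩ N'` ⟹ on `I_𝔓 ∩ N` ⟹ principal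
    refine exists_principal_on_of_vanish_on_inf_ker hcard (𝔓.inertia (absoluteGaloisGroup K)) w
      fun g hgI hgN ↦ ?_
    exact apply_eq_zero_of_mem_ker_of_vanish_on_inf hpA N' hu (𝔓.inertia (absoluteGaloisGroup K)) w
      (fun g' hg'I hg'N ↦ by rw [hwN g' hg'N]; exact hI v hv 𝔓 h𝔓 g' hg'N hg'I) hgI
      ((HerbrandLineRestriction.mem_ker_toPermHom_iff g).1 hgN)

end Link

/-! ## §4 THE REVERSE BRIDGE: `#V ≤ #H¹(Γ_ℚ, A; S)` -/

section Reverse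

variable {A : Type} [AddCommGroup A] [DistribMulAction (absoluteGaloisGroup ℚ) A] [TopologicalSpace A] [DiscreteTopology A]
variable {L : Type} [Field L] [NumberField L] [IsGalois ℚ L]

/-- **THE REVERSE BRIDGE.** `A` a discrete `Γ_ℚ`-module of prime order `p` with continuous orbit maps, acted on through
`θ : Γ_ℚ →* 𝔽_pˣ` (`g • a = θ(g) • a`); `L/ℚ` finite Galois with `p ∤ [L:ℚ]` and `θ` trivial on `res Γ_L`; `S` a set of finite places of
`ℚ`; `V` a FINITE subgroup of characters `κ : Γ_L →* 𝔽_p` with open kernel, trivial on the inertia group of every prime of `\bar ℤ_L` above a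
place `u` with `u ∩ ℚ ∉ S`, and `θ`-isotypic under the outer action of `Γ_ℚ` (`κ(θ_γ σ) = κ(σ)^{θ(γ)}`). THEN **`#V ≤ #h1Unramified A S`**:
`κ ↦ [w_κ]`, the class of §3 through the transport of §2 (`N' = res Γ_L`), is injective (a class vanishing on `N'` has `κ = 1`; two classes
with the same image differ by a coboundary, which vanishes on `N'`). The converse of seat g9's `exists_characters_natCard_h1Unramified_le`
(`#h1Unramified A S ≤ #V` for `V` = ALL such characters): with both, `#H¹(Γ_ℚ, A; S)` IS the number of `θ`-isotypic characters of `Γ_L`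
unramified outside `S`. USE (B1, CASE R): a supply of `p²` `ψ`-isotypic characters of `Γ_{K'}` unramified outside `p` (Kummer theory on
`θ_e`-radicals: Herbrand's unit + a class radical when `θ_e` is irregular) gives `#R_rel(ψ) ≥ p²`, the hypothesis of
`exists_sha_ne_zero_of_forall_exists_adaptedRoot_of_sq_le_of_cmRamified`. [cite: SerreGaloisCohomology1997, I.§2.6 (b)]
[cite: NeukirchSchmidtWingberg2008, (1.6.7)] [cite: NeukirchANT1999, Ch. IV §1] -/
theorem natCard_characters_le_natCard_h1Unramified (hcard : Nat.card A = p)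
    (hcont : ∀ a : A, Continuous fun g : absoluteGaloisGroup ℚ ↦ g • a)
    (θ : absoluteGaloisGroup ℚ →* (ZMod p)ˣ)
    (hθ : ∀ (g : absoluteGaloisGroup ℚ) (a : A), g • a = (((θ g : ZMod p).val : ℕ) : ℤ) • a)
    (hpL : ¬ p ∣ Module.finrank ℚ L) (hrL : ∀ σ : absoluteGaloisGroup L, θ (absGaloisRestrict ℚ L σ) = 1)
    {S : Set (HeightOneSpectrum (𝓞 ℚ))} (hS : S.Finite)
    (V : Subgroup (absoluteGaloisGroup L →* Multiplicative (ZMod p))) [Finite V]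
    (hκ : ∀ κ ∈ V, IsOpen (κ.ker : Set (absoluteGaloisGroup L)))
    (hunr : ∀ κ ∈ V, ∀ u : HeightOneSpectrum (𝓞 L), u.under (𝓞 ℚ) ∉ S →
      ∀ 𝔔 ∈ u.primesAbove, ∀ g ∈ 𝔔.inertia (absoluteGaloisGroup L), κ g = 1)
    (heq : ∀ κ ∈ V, ∀ (γ : absoluteGaloisGroup ℚ) (σ : absoluteGaloisGroup L),
      κ (absGaloisOuterConj ℚ L γ σ) = κ σ ^ ((θ γ : (ZMod p)ˣ) : ZMod p).val) :
    Nat.card V ≤ Nat.card ↥(h1Unramified A S) := by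
  haveI : NeZero p := ⟨hp.out.ne_zero⟩
  -- `N' = res Γ_L`: normal, open, index `[L:ℚ]` prime to `p`, acting trivially on `A`
  set N' : Subgroup (absoluteGaloisGroup ℚ) := (absGaloisRestrict ℚ L).range with hN'
  haveI : N'.Normal := normal_range_absGaloisRestrict ℚ L
  obtain ⟨hopen, hidx⟩ := Literature.NumberTheory.Automorphic.isOpen_range_absGaloisRestrict_and_index ℚ L
  have hidx0 : N'.index ≠ 0 := by rw [hN', hidx]; exact Module.finrank_pos.ne'
  have hcop : Nat.Coprime N'.index p := by
    rw [hN', hidx]; exact Nat.coprime_comm.mp ((Nat.Prime.coprime_iff_not_dvd hp.out).2 hpL)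
  have hN'le : N' ≤ (MulAction.toPermHom (absoluteGaloisGroup ℚ) A).ker := by
    rintro n ⟨σ, rfl⟩
    refine (HerbrandLineRestriction.mem_ker_toPermHom_iff _).2 fun a ↦ ?_
    change absGaloisRestrict ℚ L σ • a = a
    rw [hθ, hrL, Units.val_one, ZMod.val_one, Nat.cast_one, one_zsmul]
  have htriv : ∀ n ∈ N', ∀ a : A, n • a = a := fun n hn ↦ (HerbrandLineRestriction.mem_ker_toPermHom_iff n).1 (hN'le hn)
  -- `e : A ≃+ ℤ/p`
  haveI : IsAddCyclic A := isAddCyclic_of_prime_card hcard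
  let e : A ≃+ ZMod p := addEquivOfAddCyclicCardEq (by rw [hcard, Nat.card_zmod])
  -- for each non-trivial `κ ∈ V`: a class of `H¹(Γ_ℚ, A; S)` restricting to `e⁻¹ ∘ κ` on `N'`
  have key : ∀ κ ∈ V, κ ≠ 1 → ∃ w : contOneCocycles (discreteTopRep (absoluteGaloisGroup ℚ) A),
      oneCocycleClass _ w ∈ h1Unramified A S ∧
      ∀ σ : absoluteGaloisGroup L, w.1 (absGaloisRestrict ℚ L σ) = e.symm (Multiplicative.toAdd (κ σ)) := by
    intro κ hκV hκ1
    obtain ⟨G, hGc, hGadd, hGconj, hGI, hGres, hGne⟩ := exists_addHom_on_range_of_absGaloisHom_outside θ S κ hκ1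
      (hκ κ hκV) (hunr κ hκV) (heq κ hκV)
    obtain ⟨w, -, hwN, hwI⟩ := exists_class_of_hom_of_le_ker_outside (K := ℚ) hcard hcont N' hopen hN'le hidx0 hcop S
      (fun g ↦ e.symm (G g)) (continuous_of_discreteTopology.comp hGc)
      (fun a ha b hb ↦ by rw [hGadd a ha b hb, map_add])
      (fun g m hm ↦ by
        apply e.injective
        rw [e.apply_symm_apply, hGconj g m hm, hθ g, map_zsmul, e.apply_symm_apply, zsmul_eq_mul, Int.cast_natCast,
          ZMod.natCast_zmod_val])
      (fun v hv 𝔓 h𝔓 m hm hmI ↦ by rw [hGI v hv 𝔓 h𝔓 m hm hmI, map_zero])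
      (by
        obtain ⟨m, hm, hGm⟩ := hGne
        exact ⟨m, hm, fun h ↦ hGm (e.symm.map_eq_zero_iff.1 h)⟩)
    refine ⟨w, mem_h1Unramified_iff.2 fun v hv 𝔓 h𝔓 ↦ ?_, fun σ ↦ ?_⟩
    · obtain ⟨a, ha⟩ := hwI v hv 𝔓 h𝔓
      exact (oneCocycleClass_mem_subgroupResKer_iff _ w).2 ⟨a, fun g ↦ ha g g.2⟩
    · have h := hwN (absGaloisRestrict ℚ L σ) ⟨σ, rfl⟩
      rw [h]
      change e.symm (G (absGaloisRestrict ℚ L σ)) = _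
      rw [hGres]
  -- the map `κ ↦ [w_κ]` (and `1 ↦ 0`) is injective
  choose w hwmem hwres using key
  haveI : Finite A := Nat.finite_of_card_ne_zero (by rw [hcard]; exact hp.out.ne_zero)
  haveI : Finite ↥(h1Unramified A S) := finite_h1Unramified_of_continuous A hcont hS
  -- a class vanishing (resp. two classes agreeing) forces `κ = 1` (resp. `κ₁ = κ₂`): coboundaries vanish on `N'`
  have hvan : ∀ (κ₁ κ₂ : absoluteGaloisGroup L →* Multiplicative (ZMod p))
      (w₁ w₂ : contOneCocycles (discreteTopRep (absoluteGaloisGroup ℚ) A)),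
      (∀ σ, w₁.1 (absGaloisRestrict ℚ L σ) = e.symm (Multiplicative.toAdd (κ₁ σ))) →
      (∀ σ, w₂.1 (absGaloisRestrict ℚ L σ) = e.symm (Multiplicative.toAdd (κ₂ σ))) →
      oneCocycleClass _ w₁ = oneCocycleClass _ w₂ → κ₁ = κ₂ := by
    intro κ₁ κ₂ w₁ w₂ h₁ h₂ hcl
    have h0 : oneCocycleClass _ (w₁ - w₂) = 0 := by rw [oneCocycleClass_sub, hcl, sub_self]
    obtain ⟨a, ha⟩ := (oneCocycleClass_eq_zero_iff _ _).1 h0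
    ext σ
    have h := ha (absGaloisRestrict ℚ L σ)
    rw [Submodule.coe_sub, ContinuousMap.sub_apply, h₁, h₂] at h
    change _ = absGaloisRestrict ℚ L σ • a - a at h
    rw [htriv (absGaloisRestrict ℚ L σ) ⟨σ, rfl⟩, sub_self, sub_eq_zero, e.symm.apply_eq_iff_eq, Multiplicative.toAdd.apply_eq_iff_eq] at h
    rw [h]
  let f : V → ↥(h1Unramified A S) := fun κ ↦
    if h : (κ : absoluteGaloisGroup L →* Multiplicative (ZMod p)) = 1 then 0
    else ⟨oneCocycleClass _ (w κ.1 κ.2 h), hwmem κ.1 κ.2 h⟩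
  refine Nat.card_le_card_of_injective f fun κ₁ κ₂ hf ↦ Subtype.ext ?_
  by_cases h1 : (κ₁ : absoluteGaloisGroup L →* Multiplicative (ZMod p)) = 1 <;>
    by_cases h2 : (κ₂ : absoluteGaloisGroup L →* Multiplicative (ZMod p)) = 1
  · rw [h1, h2]
  · exfalso
    simp only [f, dif_pos h1, dif_neg h2] at hf
    have hcl : oneCocycleClass _ (0 : contOneCocycles (discreteTopRep (absoluteGaloisGroup ℚ) A)) =
        oneCocycleClass _ (w κ₂.1 κ₂.2 h2) := by
      rw [oneCocycleClass_zero]; exact (congrArg Subtype.val hf).trans rfl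
    exact h2 (hvan 1 κ₂.1 0 _ (fun σ ↦ by simp) (hwres κ₂.1 κ₂.2 h2) hcl).symm
  · exfalso
    simp only [f, dif_neg h1, dif_pos h2] at hf
    have hcl : oneCocycleClass _ (w κ₁.1 κ₁.2 h1) =
        oneCocycleClass _ (0 : contOneCocycles (discreteTopRep (absoluteGaloisGroup ℚ) A)) := by
      rw [oneCocycleClass_zero]; exact congrArg Subtype.val hf
    exact h1 (hvan κ₁.1 1 _ 0 (hwres κ₁.1 κ₁.2 h1) (fun σ ↦ by simp) hcl)
  · simp only [f, dif_neg h1, dif_neg h2, Subtype.mk.injEq] at hf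
    exact hvan κ₁.1 κ₂.1 _ _ (hwres κ₁.1 κ₁.2 h1) (hwres κ₂.1 κ₂.2 h2) hf

end Reverse

end Summit.BirchSwinnertonDyer.BirchSwinnertonDyer.Theorems.PrintCFram.SelmerCount

end
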